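import Summits.CriticalPhenomena.PercolationContinuityZ3.Theorems.PercNearOneGluingNoHeavyQuantURPMIdentity
import HarnessLib

/-!
# QUANT lane R8, T-DEC: the U-RPM identity LIFTED — from the pattern identities of `…QuantURPMIdentity` to the mixture identity for ANY
# assignment of laws to root patterns (census-1 gen 25)

builds on p205010 (kernel theorem, internal audit signed; external expert review pending)

Support file (`--supports stmt-CriticalPhenomena-4575`), QUANT lane seat prim-quant-census-1 (gen 25); memo
`run/shared/lean/prim/quant/prim-quant-census-1/g25/URPM-G25.md`.  Sequel of `…QuantURPMIdentity` (✓ p492829: closed-form weights `urpmW`, the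
Hurwitz-type identity `hurwitz_gen`, `urpm_pattern`, `urpm_empty`).  Small `def`s, theorems with standard axioms, no sorries.

WHY.  arm-1 g52's recursion (✓ p486817/p487332/p487604, RATE-PLAN 53.6–53.8) reduces `LightResidDECOracle` along a heavy-head peeling order to
the DEC of the U-parts `gate_{a q}(ρ ∗ H)`, `H = (flaw L′ − (1 − q)δ₀)/q`, and a DEC certificate for `H`'s gating needs `H` as a MIXTURE OF LAWS each
covered by the oracle.  `…QuantURPMIdentity` gives the mixture at the level of root patterns; this file performs the bookkeeping once and for all:
for ANY map `X : Finset ι → V` into a real vector space ("the law attached to the open-root set `A`", e.g. `X_A = ∗_{t∈A} ρ_t` in `ℕ → ℝ`),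
  `q₁ • Σ_{∅≠E⊆R} w_E • (Σ_{A⊆E} P_E(A) • X_A) = Σ_{A⊆R} π_A • X_A − (1 − q₁) • X_∅`   (`urpm_lift`),
`P_E(A) = Π_{t∈A}(l_t/s_E)·Π_{t∈E∖A}(1 − l_t/s_E)` the pattern law of the proportional product on `E`, `π_A = Π_{t∈A}(q₁l_t)·Π_{t∉A}(1 − q₁l_t)` the
product pattern weight, shares `c_t > 0` with `Σ_R c = 1`, `s_E = c(E)`, `w_E = urpmW` (all `≥ 0`, total `1`: `urpmW_nonneg`, `urpm_total`).  With
`X_A` the convolution of the opened sub-forest laws of `A`, the right side is `flaw L′ − (1 − q₁)δ₀ = q₁·H` and `Σ_{A⊆E} P_E(A)•X_A` is the law of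
the forest `E` re-gated to openness `l_t/s_E` — the U-TERM ROOT-PATTERN MIXTURE of ARCH-G52 §3.2 at law level, every width; what remains for the
width-`k` heavy-single balanced sibling step is only the pattern expansion of `flaw` and the oracle calls (architect/typer).
* `patP`, `piP`, `lawE`; `pow_mul_patP` (clearing denominators), `filter_supset_eq_image` (components above a pattern); **`urpm_lift`**.
HONEST STATUS: pure algebra; `LightResidDECOracle`, `SiblingStep`, `GateStepN`, `FarTreeRow` OPEN; RATE class log\* / honest sentence of
`run/shared/lean/prim/quant/README.md` unchanged.  [this work]; setting: prim-quant-arm-1 g52.  Nothing here is cited as a published result.  The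
gluing rows served [cite: KozmaNitzan2024, Conjecture 3 (p. 15)]; product measure [cite: Grimmett1999, §1.3 p. 10].
-/

noncomputable section

open Finset
open scoped BigOperators

namespace Summit.CriticalPhenomena.PercolationContinuityZ3.Theorems
namespace Quant
namespace URPM

variable {ι : Type*}

/-! ### The lift -/

section Lift

variable {V : Type*} [AddCommGroup V] [Module ℝ V]

/-- `P_E(exactly A open) = Π_{t∈A} (l_t/s_E) · Π_{t∈E∖A} (1 − l_t/s_E)`, the pattern probabilities of the proportional product on `E`
(`s_E = c(E)`; meaningful for `A ⊆ E`). [this work] -/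
def patP (c l : ι → ℝ) [DecidableEq ι] (E A : Finset ι) : ℝ :=
  (∏ t ∈ A, l t / asum c E) * ∏ t ∈ E \ A, (1 - l t / asum c E)

/-- the product pattern weight `π_A = Π_{t∈A} (q₁ l_t) · Π_{t∈R∖A} (1 − q₁ l_t)`. [this work] -/
def piP (q₁ : ℝ) (l : ι → ℝ) [DecidableEq ι] (R A : Finset ι) : ℝ :=
  (∏ t ∈ A, (q₁ * l t)) * ∏ t ∈ R \ A, (1 - q₁ * l t)

/-- the law of the component `E` assembled from pattern laws `X_A`: `Σ_{A⊆E} P_E(A) • X_A`. [this work] -/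
def lawE (c l : ι → ℝ) [DecidableEq ι] (X : Finset ι → V) (E : Finset ι) : V :=
  ∑ A ∈ E.powerset, patP c l E A • X A

/-- clearing denominators: `s_E^{|E|}·P_E(A) = Π_{t∈A} l_t · Π_{t∈E∖A} (s_E − l_t)` (`A ⊆ E`, `s_E ≠ 0`). [this work] -/
theorem pow_mul_patP [DecidableEq ι] (c l : ι → ℝ) {E A : Finset ι} (hAE : A ⊆ E) (hs : asum c E ≠ 0) :
    asum c E ^ E.card * patP c l E A = (∏ t ∈ A, l t) * ∏ t ∈ E \ A, (asum c E - l t) := by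
  unfold patP
  have hcard : E.card = A.card + (E \ A).card := by
    rw [Finset.card_sdiff, Finset.inter_eq_left.2 hAE]; have := Finset.card_le_card hAE; omega
  rw [hcard, pow_add, mul_mul_mul_comm, ← Finset.prod_const, ← Finset.prod_const, ← Finset.prod_mul_distrib,
    ← Finset.prod_mul_distrib]
  congr 1
  · exact Finset.prod_congr rfl fun t _ => mul_div_cancel₀ (l t) hs
  · exact Finset.prod_congr rfl fun t _ => by rw [mul_sub, mul_one, mul_div_cancel₀ (l t) hs]

/-- the components containing a nonempty `A ⊆ R` are `E = A ∪ G`, `G ⊆ R∖A`. [this work] -/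
theorem filter_supset_eq_image [DecidableEq ι] {R A : Finset ι} (hAR : A ⊆ R) (hA : A.Nonempty) :
    (R.powerset.erase ∅).filter (fun E => A ⊆ E) = ((R \ A).powerset).image (fun G => A ∪ G) := by
  ext E
  simp only [Finset.mem_filter, Finset.mem_erase, Finset.mem_powerset, Finset.mem_image]
  constructor
  · rintro ⟨⟨_, hER⟩, hAE⟩
    exact ⟨E \ A, Finset.sdiff_subset_sdiff hER le_rfl, Finset.union_sdiff_of_subset hAE⟩
  · rintro ⟨G, hG, rfl⟩
    refine ⟨⟨fun h => ?_, Finset.union_subset hAR (hG.trans Finset.sdiff_subset)⟩, Finset.subset_union_left⟩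
    obtain ⟨t, ht⟩ := hA
    have : t ∈ A ∪ G := Finset.mem_union_left G ht
    rw [h] at this
    exact absurd this (Finset.notMem_empty t)

/-- **THE LIFT.**  For ANY assignment `X` of "pattern laws" (in any real vector space) and shares `c > 0` on `R ≠ ∅` summing to `1`:
`q₁ • Σ_{∅≠E⊆R} w_E • (Σ_{A⊆E} P_E(A) • X_A) = Σ_{A⊆R} π_A • X_A − (1 − q₁) • X_∅`.  With `X_A` = the convolution of the opened sub-forest laws of
`A`, the right side is `flaw − (1 − q₁)δ₀ = q₁·H` and each `Σ_{A⊆E} P_E(A) • X_A` is the law of the proportional-product forest on `E`: the U-TERM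
ROOT-PATTERN MIXTURE at law level, every width. [this work] -/
theorem urpm_lift [DecidableEq ι] (q₁ : ℝ) (c l : ι → ℝ) (R : Finset ι) (hR : R.Nonempty) (hc : asum c R = 1)
    (hcpos : ∀ t ∈ R, 0 < c t) (X : Finset ι → V) :
    q₁ • ∑ E ∈ R.powerset.erase ∅, urpmW q₁ c R E • lawE c l X E =
      (∑ A ∈ R.powerset, piP q₁ l R A • X A) - (1 - q₁) • X ∅ := by
  have hsne : ∀ E ∈ R.powerset.erase ∅, asum c E ≠ 0 := by
    intro E hE
    have hER : E ⊆ R := Finset.mem_powerset.1 (Finset.mem_of_mem_erase hE)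
    have hEne : E.Nonempty := Finset.nonempty_iff_ne_empty.2 (Finset.ne_of_mem_erase hE)
    exact ne_of_gt (Finset.sum_pos (fun t ht => hcpos t (hER ht)) hEne)
  -- expand the component laws and swap the sums
  have hswap : ∑ E ∈ R.powerset.erase ∅, urpmW q₁ c R E • lawE c l X E =
      ∑ A ∈ R.powerset, (∑ E ∈ (R.powerset.erase ∅).filter (fun E => A ⊆ E), urpmW q₁ c R E * patP c l E A) • X A := by
    unfold lawE
    simp_rw [Finset.smul_sum, smul_smul, Finset.sum_smul]
    refine Finset.sum_comm' fun E A => ?_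
    simp only [Finset.mem_filter, Finset.mem_powerset, Finset.mem_erase]
    constructor
    · rintro ⟨⟨hE, hER⟩, hAE⟩; exact ⟨⟨⟨hE, hER⟩, hAE⟩, hAE.trans hER⟩
    · rintro ⟨⟨⟨hE, hER⟩, hAE⟩, _⟩; exact ⟨⟨hE, hER⟩, hAE⟩
  -- the inner sums: nonempty patterns by `urpm_pattern`, the empty pattern by `urpm_empty`
  have hinner : ∀ A ∈ R.powerset.erase ∅,
      q₁ * ∑ E ∈ (R.powerset.erase ∅).filter (fun E => A ⊆ E), urpmW q₁ c R E * patP c l E A = piP q₁ l R A := by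
    intro A hA
    have hAR : A ⊆ R := Finset.mem_powerset.1 (Finset.mem_of_mem_erase hA)
    have hAne : A.Nonempty := Finset.nonempty_iff_ne_empty.2 (Finset.ne_of_mem_erase hA)
    have hdisj : ∀ G, G ⊆ R \ A → Disjoint A G := fun G hG => Finset.disjoint_of_subset_right hG Finset.disjoint_sdiff
    rw [filter_supset_eq_image hAR hAne, Finset.sum_image (fun G hG G' hG' hGG => by
      have hG1 := Finset.mem_powerset.1 hG
      have hG2 := Finset.mem_powerset.1 hG'
      rw [← Finset.union_sdiff_cancel_left (hdisj G hG1), hGG, Finset.union_sdiff_cancel_left (hdisj G' hG2)])]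
    have hterm : ∀ G ∈ (R \ A).powerset, urpmW q₁ c R (A ∪ G) * patP c l (A ∪ G) A =
        urpmWr q₁ c R (A ∪ G) * ((∏ t ∈ A, l t) * ∏ t ∈ G, (asum c A + asum c G - l t)) := by
      intro G hG
      have hG' := Finset.mem_powerset.1 hG
      have hEm : A ∪ G ∈ R.powerset.erase ∅ := Finset.mem_erase.2 ⟨Finset.nonempty_iff_ne_empty.1 (hAne.mono Finset.subset_union_left),
        Finset.mem_powerset.2 (Finset.union_subset hAR (hG'.trans Finset.sdiff_subset))⟩
      rw [urpmW_eq q₁ c R _ hc, mul_assoc, pow_mul_patP c l Finset.subset_union_left (hsne _ hEm),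
        Finset.union_sdiff_cancel_left (hdisj G hG')]
      unfold asum
      rw [Finset.sum_union (hdisj G hG')]
    rw [Finset.sum_congr rfl hterm, urpm_pattern q₁ c l R A hAR hAne hc]
    unfold piP
    rw [Finset.prod_mul_distrib, Finset.prod_const]
    have : q₁ * q₁ ^ (A.card - 1) = q₁ ^ A.card := by
      rw [← pow_succ', Nat.sub_add_cancel (Finset.card_pos.2 hAne)]
    rw [← mul_assoc, ← mul_assoc, this]
  have hinner0 : q₁ * ∑ E ∈ (R.powerset.erase ∅).filter (fun E => ∅ ⊆ E), urpmW q₁ c R E * patP c l E ∅ =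
      piP q₁ l R ∅ - (1 - q₁) := by
    rw [Finset.filter_true_of_mem fun E _ => Finset.empty_subset E]
    have hterm : ∀ E ∈ R.powerset.erase ∅, urpmW q₁ c R E * patP c l E ∅ = urpmWr q₁ c R E * ∏ t ∈ E, (asum c E - l t) := by
      intro E hE
      rw [urpmW_eq q₁ c R _ hc, mul_assoc, pow_mul_patP c l (Finset.empty_subset E) (hsne E hE), Finset.prod_empty, one_mul,
        Finset.sdiff_empty]
    rw [Finset.sum_congr rfl hterm, urpm_empty q₁ c l R hR hc]
    unfold piP
    rw [Finset.prod_empty, one_mul, Finset.sdiff_empty]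
  -- assemble
  rw [hswap, Finset.smul_sum, ← Finset.sum_erase_add _ _ (Finset.empty_mem_powerset R),
    ← Finset.sum_erase_add (R.powerset) _ (Finset.empty_mem_powerset R)]
  simp_rw [smul_smul]
  rw [hinner0, Finset.sum_congr rfl fun A hA => by rw [hinner A hA], sub_smul]
  abel

end Lift

end URPM
end Quant
end Summit.CriticalPhenomena.PercolationContinuityZ3.Theorems
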